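import Mathlib
import Summits.Ventures.PercRepro2.CrossAPrimeEdgeIdentities
import Summits.Ventures.PercRepro2.CrossAPrimeMixedSign

/-!
# The single-edge Bernstein positivity as the open statement: `BernStep`
(blind cell PercRepro2, p5 g33; `proofs/P5-OEDGE.md` §43, S4 §2.4 (s) addendum 25)

Along a root edge `e = {r, w}` the one-edge cubic is
`crossA′so(p) = (1 − q)³B₀ + 3q(1 − q)²B₁ + 3q²(1 − q)B₂ + q³B₃` (`crossA'so_pin_cubic`), so the
induction of `CrossAPrimeInduction.crossA'so_nonneg_of_step` (loops removed, a random edge at the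
sure cluster of the root split after re-rooting, the deterministic base by Harris) closes as soon
as the two MIDDLE coefficients are nonnegative under the induction hypotheses `0 ≤ B₀`, `0 ≤ B₃`:
**`BernStep`** := `0 ≤ 3B₁ ∧ 0 ≤ 3B₂` for every random root edge with `w ∉ {a₂, v}`.  This is
weaker than the reduction form `RootEdgeReductionStep` at `q → 0` (which asks `3B₁ ≥ B₀`) and than
`MixedSign` (`E₂ ≥ B₃`, which gives both: `3B₂ = E₂ + B₃` and `3B₁ = E₁ + B₀ ≥ E₂ + B₀`):
**`bernStep_of_mixedSign`**.  **`crossA'so_nonneg_of_bernStep`**: `BernStep` gives the sign for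
every weight vector and root (the predecessor's induction with the cubic in place of the
reduction).  Own work; standard axioms.
-/

namespace Summit.Ventures.PercRepro2

open LeafRowPendantRootSO CrossAPrimeA1VMid CrossAPrimeSupport CrossAPrimeRootEdge
  CrossAPrimeInduction CrossAPrimeEdgeIdentities CrossAPrimeMixedSign

namespace CrossAPrimeBernStep

section Main

variable {V : Type*} {E : Type*} [Fintype E] [DecidableEq E] [Fintype V] [DecidableEq V]
  {R : Type*} [Field R] [LinearOrder R] [IsStrictOrderedRing R]
variable {ends : E → Sym2 V}

/-- **The single-edge Bernstein positivity**: along every random root edge `e = {r, w}`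
(`w ∉ {a₂, v}`), under the induction hypotheses `0 ≤ crossA′so(p[e ↦ 0])`,
`0 ≤ crossA′so(p[e ↦ 1])`, the middle coefficients are nonnegative: `0 ≤ E₁ + B₀ (= 3B₁)` and
`0 ≤ E₂ + B₃ (= 3B₂)`. -/
def BernStep (ends : E → Sym2 V) (o a₂ v b : V) : Prop :=
  ∀ (p : E → R) (r w : V) (e : E), IsProbVec p → ends e = s(r, w) → r ≠ w → w ≠ a₂ → w ≠ v →
    p e ≠ 0 → p e ≠ 1 →
    0 ≤ crossA'so (Function.update p e 0) ends o r a₂ v b →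
    0 ≤ crossA'so (Function.update p e 1) ends o r a₂ v b →
    0 ≤ E1 p e ends o r a₂ v b + crossA'so (Function.update p e 0) ends o r a₂ v b ∧
      0 ≤ E2 p e ends o r a₂ v b + crossA'so (Function.update p e 1) ends o r a₂ v b

omit [Fintype V] [DecidableEq V] in
/-- The one-edge cubic is nonnegative once its four coefficients are. -/
lemma crossA'so_nonneg_of_coeffs {p : E → R} (hp : IsProbVec p) (e : E) (o a₁ a₂ v b : V)
    (h0 : 0 ≤ crossA'so (Function.update p e 0) ends o a₁ a₂ v b)
    (h3 : 0 ≤ crossA'so (Function.update p e 1) ends o a₁ a₂ v b)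
    (h1 : 0 ≤ E1 p e ends o a₁ a₂ v b + crossA'so (Function.update p e 0) ends o a₁ a₂ v b)
    (h2 : 0 ≤ E2 p e ends o a₁ a₂ v b + crossA'so (Function.update p e 1) ends o a₁ a₂ v b) :
    0 ≤ crossA'so p ends o a₁ a₂ v b := by
  have hq0 : 0 ≤ p e := hp.nonneg e
  have hq1 : p e ≤ 1 := hp.le_one e
  rw [crossA'so_eq_excess p e ends o a₁ a₂ v b]
  have k0 := mul_nonneg (pow_nonneg (sub_nonneg.2 hq1) 3) h0
  have k1 := mul_nonneg (mul_nonneg hq0 (sq_nonneg (1 - p e))) h1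
  have k2 := mul_nonneg (mul_nonneg (sq_nonneg (p e)) (sub_nonneg.2 hq1)) h2
  have k3 := mul_nonneg (pow_nonneg hq0 3) h3
  linarith

omit [Fintype V] in
/-- `MixedSign` gives `BernStep`: `3B₂ = E₂ + B₃ ≥ 2B₃ ≥ 0` and `3B₁ = E₁ + B₀ ≥ E₂ + B₀ ≥ 0`. -/
theorem bernStep_of_mixedSign {o a₂ v b : V} (H : MixedSign (R := R) ends o a₂ v b) :
    BernStep (R := R) ends o a₂ v b := by
  intro p r w e hp he hrw hw2 hwv h0 h1 hs0 hs1
  have hmix := H p r w e hp he hrw hw2 hwv h0 h1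
  have hE2 : crossA'so (Function.update p e 1) ends o r a₂ v b ≤ E2 p e ends o r a₂ v b := by
    have := E2_sub_B3 p e ends o r a₂ v b
    linarith
  have hE1 := E2_le_E1 hp he o a₂ v b
  exact ⟨by linarith, by linarith⟩

/-- **The induction from `BernStep`**: the sign of `crossA′so` for every weight vector and root. -/
theorem crossA'so_nonneg_of_bernStep {o a₂ v b : V} (H : BernStep (R := R) ends o a₂ v b) :
    ∀ (p : E → R), IsProbVec p → ∀ a₁, 0 ≤ crossA'so p ends o a₁ a₂ v b := by
  suffices h : ∀ n, ∀ (p : E → R), IsProbVec p → (randomEdges p).card = n →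
      ∀ a₁, 0 ≤ crossA'so p ends o a₁ a₂ v b from fun p hp a₁ => h _ p hp rfl a₁
  intro n
  induction n with
  | zero =>
    intro p hp hcard a₁
    apply crossA'so_nonneg_of_det hp
    intro e _
    by_contra hne
    rw [not_or] at hne
    have : e ∈ randomEdges p := by
      simp only [randomEdges, Finset.mem_filter, Finset.mem_univ, true_and]
      exact hne
    rw [Finset.card_eq_zero] at hcard
    rw [hcard] at this
    exact absurd this (Finset.notMem_empty e)
  | succ n ih =>
    intro p hp hcard a₁
    by_cases hdet : ∀ e ∈ touches ends (cluster ends (sureConfig p) a₁), p e = 0 ∨ p e = 1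
    · exact crossA'so_nonneg_of_det hp hdet o a₂ v b
    · simp only [not_forall, not_or] at hdet
      obtain ⟨e, he, h0, h1⟩ := hdet
      obtain ⟨t, ht, w, hew⟩ := he
      have hp0 : IsProbVec (Function.update p e 0) := hp.update e le_rfl zero_le_one
      have hp1 : IsProbVec (Function.update p e 1) := hp.update e zero_le_one le_rfl
      have hmem : e ∈ randomEdges p := by
        simp only [randomEdges, Finset.mem_filter, Finset.mem_univ, true_and]
        exact ⟨h0, h1⟩
      have hcard0 : (randomEdges (Function.update p e 0)).card = n := by
        rw [randomEdges_update_zero, Finset.card_erase_of_mem hmem, hcard]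
        rfl
      have hcard1 : (randomEdges (Function.update p e 1)).card = n := by
        rw [randomEdges_update_one, Finset.card_erase_of_mem hmem, hcard]
        rfl
      have hind := ih _ hp0 hcard0 a₁
      by_cases htw : t = w
      · subst htw
        rw [crossA'so_update_loop hew p o a₁ a₂ v b] at hind
        exact hind
      · have htc : Conn ends (sureConfig p) a₁ t := ht
        have hre := crossA'so_reroot (R := R) p htc o a₂ v b
        have hsure := sureConfig_update_zero (R := R) p h1
        have htc0 : Conn ends (sureConfig (Function.update p e 0)) a₁ t := by
          rw [hsure]
          exact htc
        have hre0 := crossA'so_reroot (R := R) (Function.update p e 0) htc0 o a₂ v b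
        have hind1 := ih _ hp1 hcard1 a₁
        have hsure1 : sureConfig (Function.update p e 1) =
            Function.update (sureConfig p) e true := by
          funext f
          by_cases hf : f = e
          · subst hf
            simp [sureConfig]
          · simp [sureConfig, Function.update_of_ne hf]
        have htc1 : Conn ends (sureConfig (Function.update p e 1)) a₁ t := by
          rw [hsure1]
          exact conn_mono (fun f => by
            by_cases hf : f = e
            · subst hf; simp
            · simp [Function.update_of_ne hf]) htc
        have hre1 := crossA'so_reroot (R := R) (Function.update p e 1) htc1 o a₂ v b
        rw [hre0] at hind
        rw [hre1] at hind1
        rw [hre]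
        by_cases hw2 : w = a₂
        · subst hw2
          have hH := crossA'so_root_edge hp hew (o := o) (v := v) (b := b)
          have := mul_nonneg (sq_nonneg (1 - p e)) hind
          linarith [hH, this]
        · by_cases hwv : w = v
          · subst hwv
            have hH := crossA'so_a1v_edge hp hew o a₂ b
            have := mul_nonneg (sq_nonneg (1 - p e)) hind
            linarith [hH, this]
          · obtain ⟨hB1, hB2⟩ := H p t w e hp hew htw hw2 hwv h0 h1 hind hind1
            exact crossA'so_nonneg_of_coeffs hp e o t a₂ v b hind hind1 hB1 hB2

end Main

end CrossAPrimeBernStep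

end Summit.Ventures.PercRepro2
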